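import Summits.QuantumFields.YangMills.Theorems.UnitScaleTiltProp7RLegsCovKnit
import Summits.QuantumFields.YangMills.Theorems.UnitScaleTiltProp7RLegsCovScalarB
import HarnessLib

/-!
# `UnitScaleTiltProp7RLegsCovKnitB` — LANE II (R-LEGS), (K2′): ★★★ THE MEMBER KNIT OF (R-LEGS-cov) FROM THE TWO `ℓ⁻²`-ANCHORED PER-LEVEL ROWS (hG♭) ∕ (hN♭)
# OF THE COMB LINEAR TOWER `Y_l = D[Ũˡ]·A` — the re-cut of ✓(K2) `Prop7RLegsCovKnit.covGradLegs_of_linTower_rows` accepting the rows in the shape ★routeR's lane closes them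
# (crux `MinimiserStabilityRegPr`, stmt-QuantumFields-19200, EX lane, hN06 LANE II supplier (R-LEGS); `--supports stmt-QuantumFields-19200 --as helper`, count-neutral)

Cell `ym3-torus` (HUMAN RULING D-0037: YM₃ on T³ is ladder rung R3 — NOT d = 4, NOT infinite volume, NOT a mass gap, NOT the Clay problem), width seat `ym-ust-20520-w4` (g13), steward of
the curved row `rlegs` ∕ the (K2) knit.  THEOREMS ONLY (0 `def`, 0 `sorry`).  The two rows (hG♭), (hN♭) are DISPLAYED HYPOTHESES (★routeR's (II) lane: px18 g5 F-8′ (a)(b) cell theorem,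
★routeR-w2 g10 F-8′ (c) member file); nothing here claims them, nor (QB), (QH1), (REC), `hN06`, EX or the crux.

THE RE-CUT (w4 g12 tolerance «any window `w(e)·Lˡ·ℓ⁻²·SA`», ★routeR-w2 g10 LOCATE #62 (4)).  ✓(K2)'s rows carried the curvature contribution `l`-sharply as `C·e²·L^{3l}·(Lᵏ)⁻⁴·SA`
(`k = K − n`, `ℓ = Lᵏ`); ★routeR's closure in the PURE B-SLOT with the TOP anchor (✓`Prop7CornerCombLambdaClosureSharp.grad_full_B_slot_of_rows`, `Ĝ = g₀ + θ_g e′m₀ρ^{2k}ρ³∕(1−ρ²)`,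
`ρ^{2k} = (Lᵏ)⁻¹`, `((ρ⁻¹)ˡ)² = Lˡ` on `T³`) delivers it `l`-UNIFORMLY as `C·e²·Lˡ·(Lᵏ)⁻²·SA` (px18 g5 F-9d-a SIGNATURE 12:47:34Z).  Here the third slot of BOTH rows is displayed in that shape,
`C·e^2·(F.L)^l·(((F.L)^(K−n))^2)⁻¹·SA`; since `e²L^{3l}ℓ⁻⁴ ≤ e²·Lˡℓ⁻²` (`l ≤ k`), (hG)⇒(hG♭) and (hN′)⇒(hN♭): this knit is STRONGER than ✓(K2) and its conclusion is the SAME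
`hCov` of ✓p707999 `rlegs_of_covGradLegs` VERBATIM (so ✓px19 g7 `hQB_of_rlegs`∕`hEng_of_rlegs` consume `rlegs_of_linTower_rowsB` unchanged).

THE CHAIN.  ✓(K2-L) `Prop7RLegsCovLevel` (member one-level steps, `D_0 = 0`, periodicity) → ✓(K2-S′) `Prop7RLegsCovScalarB.scalar_legs_knit_B`∕`legsMass_le_B` → ✓(K2-T)
`Prop7RLegsCovTop.sum_coarseBond_legs_le` + `norm_iterEML_sub_avgIter_le_of_regPr` → ✓`fderiv_frameTw_eq_fderiv_vcov` → ✓(K2) `final_arith`; constants `Cr_tot = 2Cr + 24Csw²m₂`,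
`Cr′_tot = 2Cr′ + 24Csw²m₁`, `er = min(eG, eN, 1, (10⁷L³)⁻¹)` exactly as in ✓(K2).
* §1 ★★★ `covGradLegs_of_linTower_rowsB` · §2 ★★★ `rlegs_of_linTower_rowsB` (✓p707999 ∘ §1).
HONEST SCOPE.  Given (hG♭), (hN♭) this closes `hCov` and px19's `rlegs` text; the rows are ★routeR's (II)-lane deliverables.  Rung R3; YM gap NOT proved.

References: T. Bałaban, CMP 98 (1985) 17–51 [Balaban1985Averaging] ((43) p.24, (52)–(54) p.26, (58) p.27, (97) p.32, (110)–(112) p.34, (160)–(163) p.42); CMP 102 (1985) 277–309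
[Balaban1985Variational] ((6) p.278, (146) p.301); CMP 109 (1987) 249–301 [Balaban1987RG1] ((0.1)–(0.4) pp.251–253).
-/

set_option autoImplicit false

noncomputable section

open scoped BigOperators Matrix.Norms.L2Operator Matrix

namespace Summit.QuantumFields.YangMills.Theorems.Prop7RLegsCovKnitB

open Finset
open Literature.MathematicalPhysics.QuantumFieldTheory.Balaban1983to89
open Literature.MathematicalPhysics.QuantumFieldTheory.Balaban1983to89.T3ContinuumYM3Torus
open Literature.MathematicalPhysics.QuantumFieldTheory.Balaban1983to89.T3PrintedRegularMinimiser (RegPr)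
open T4Continuum BlockAveraging AveragingRT ExpMeanLog
open T3LevelShift (bondShift)
open T3PrintedRegularOrbits (sites_eq)
open T3SectALandauChart (bgUnits)
open B7Prop1Explicit renaming Site → LSite
open B7Prop1Explicit (e expUnit U1)
open B7Prop2Explicit (avgIter)
open B7Eq92Concrete (vcov tildIter)
open B7Eq78Linearization (conjR conjR_apply)
open B10Eq27TorusAxialLog (pull unitsField toUField)
open B9Eq39Adjoint (curl divB)
open B9TorusCalculus (torusT)
open T4TermwiseTorus (IsPeriodic)
open Summit.QuantumFields.YangMills.Theorems.Prop7SPrint (basePt)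
open Summit.QuantumFields.YangMills.Theorems.Prop7SymAvgTw (frameTw coordT3)
open Summit.QuantumFields.YangMills.Theorems.Prop7CombFrameLinearResponseStep (fderiv_frameTw_eq_fderiv_vcov)
open Summit.QuantumFields.YangMills.Theorems.Prop7CombTowerWindowsOfRegPr (level_data_of_regPr)
open Summit.QuantumFields.YangMills.Theorems.Prop7RLegsCovLevel (isPeriodic_linVcov_of linVcov_zero_of legsMass_level_step_of_regPr legs_level_step_of_regPr)
open Summit.QuantumFields.YangMills.Theorems.Prop7RLegsCovScalarB (scalar_legs_knit_B legsMass_le_B)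
open Summit.QuantumFields.YangMills.Theorems.Prop7RLegsCovTop (norm_iterEML_sub_avgIter_le_of_regPr sum_coarseBond_legs_le)
open Summit.QuantumFields.YangMills.Theorems.Prop7RLegsCovKnit (final_arith sum_dir_shift_normSq_eq)

/-! ## §1 ★★★ (K2′) The member knit with the anchored rows -/

/-- ★★★ **(K2′) (R-LEGS-cov) FROM THE TWO `ℓ⁻²`-ANCHORED PER-LEVEL ROWS OF THE COMB LINEAR TOWER** — ✓p707999 `rlegs_of_covGradLegs`'s hypothesis `hCov` VERBATIM as conclusion;
hypotheses (hG♭): the covariant gradient energy of `Y_l = D[Ũˡ(W♯,(eᵗ)♯)]·A` per coarse direction `μ` is `≤ CG·Lˡ·GA + CG′·e²·Lˡ·(L^{K−n})⁻²·SA`, (hN♭): its mass is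
`≤ CN·L⁻ˡ·SA + CN′·Lˡ·GA + CN″·e²·Lˡ·(L^{K−n})⁻²·SA` (`GA = Σ_{b,ν}‖W A(b+ν) Wᴴ − A(b)‖²`, `SA = Σ_b‖A b‖²`; c2 shape, constants depending on `L` only; the third slots are the
`l`-uniform top-anchored B-slot currency of ★routeR's closure, WEAKER than ✓(K2)'s `e²L^{3l}ℓ⁻⁴`).  Proof: §THE CHAIN of the header, with ✓(K2-S′) in place of ✓(K2-S).
[cite: Balaban1985Averaging, (97) p.32, (110)–(112) p.34, (160)–(163) p.42; Balaban1985Variational, (6) p.278, (146) p.301; Balaban1987RG1, (0.1)–(0.4) pp.251–253] -/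
theorem covGradLegs_of_linTower_rowsB
    (hG : ∀ (L : ℕ), 1 < L → ∃ CG CG' eG : ℝ, 0 ≤ CG ∧ 0 ≤ CG' ∧ 0 < eG ∧
      ∀ (F : T3Family), F.L = L → ∀ (n K : ℕ) (hnK : n < K) (e : ℝ) (W : GaugeField (F.P K) 0 (Matrix.specialUnitaryGroup (Fin 2) ℂ)),
        0 < e → e ≤ eG → RegPr F n K e W → ∀ (A : PBond (F.P K) 0 → Matrix (Fin 2) (Fin 2) ℂ) (l : ℕ), l < K - n → ∀ μ : Fin (F.P K).d,
        ∑ x : Site (F.P K) l, ∑ κ : Fin (F.P K).d,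
          ‖fderiv ℂ (fun t : PBond (F.P K) 0 → Matrix (Fin 2) (Fin 2) ℂ =>
                ((tildIter (F.P K).L (pull (bgUnits F K W) (basePt F n K)) (pull (fun b => expUnit (t b)) (basePt F n K)) l (fun ν => ((x ν).val : ℤ)) κ :
                  (Matrix (Fin 2) (Fin 2) ℂ)ˣ) : Matrix (Fin 2) (Fin 2) ℂ)) 0 A
            - conjR (avgIter (F.P K).L (pull (bgUnits F K W) (basePt F n K)) l (fun ν => ((x ν).val : ℤ)) μ)
              (fderiv ℂ (fun t : PBond (F.P K) 0 → Matrix (Fin 2) (Fin 2) ℂ =>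
                ((tildIter (F.P K).L (pull (bgUnits F K W) (basePt F n K)) (pull (fun b => expUnit (t b)) (basePt F n K)) l ((fun ν => ((x ν).val : ℤ)) + B7Prop1Explicit.e μ) κ :
                  (Matrix (Fin 2) (Fin 2) ℂ)ˣ) : Matrix (Fin 2) (Fin 2) ℂ)) 0 A)‖ ^ 2
          ≤ CG * (F.L : ℝ) ^ l * (∑ b : PBond (F.P K) 0, ∑ ν : Fin (F.P K).d,
                ‖((W ⟨b.src, ν⟩ : Matrix.specialUnitaryGroup (Fin 2) ℂ) : Matrix (Fin 2) (Fin 2) ℂ) * A ⟨b.src.shift ν, b.dir⟩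
                    * star ((W ⟨b.src, ν⟩ : Matrix.specialUnitaryGroup (Fin 2) ℂ) : Matrix (Fin 2) (Fin 2) ℂ) - A b‖ ^ 2)
            + CG' * e ^ 2 * (F.L : ℝ) ^ l * (((F.L : ℝ) ^ (K - n)) ^ 2)⁻¹ * ∑ b : PBond (F.P K) 0, ‖A b‖ ^ 2)
    (hN : ∀ (L : ℕ), 1 < L → ∃ CN CN' CN'' eN : ℝ, 0 ≤ CN ∧ 0 ≤ CN' ∧ 0 ≤ CN'' ∧ 0 < eN ∧
      ∀ (F : T3Family), F.L = L → ∀ (n K : ℕ) (hnK : n < K) (e : ℝ) (W : GaugeField (F.P K) 0 (Matrix.specialUnitaryGroup (Fin 2) ℂ)),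
        0 < e → e ≤ eN → RegPr F n K e W → ∀ (A : PBond (F.P K) 0 → Matrix (Fin 2) (Fin 2) ℂ) (l : ℕ), l < K - n →
        ∑ x : Site (F.P K) l, ∑ κ : Fin (F.P K).d,
          ‖fderiv ℂ (fun t : PBond (F.P K) 0 → Matrix (Fin 2) (Fin 2) ℂ =>
                ((tildIter (F.P K).L (pull (bgUnits F K W) (basePt F n K)) (pull (fun b => expUnit (t b)) (basePt F n K)) l (fun ν => ((x ν).val : ℤ)) κ :
                  (Matrix (Fin 2) (Fin 2) ℂ)ˣ) : Matrix (Fin 2) (Fin 2) ℂ)) 0 A‖ ^ 2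
          ≤ CN * ((F.L : ℝ) ^ l)⁻¹ * ∑ b : PBond (F.P K) 0, ‖A b‖ ^ 2
            + CN' * (F.L : ℝ) ^ l * (∑ b : PBond (F.P K) 0, ∑ ν : Fin (F.P K).d,
                ‖((W ⟨b.src, ν⟩ : Matrix.specialUnitaryGroup (Fin 2) ℂ) : Matrix (Fin 2) (Fin 2) ℂ) * A ⟨b.src.shift ν, b.dir⟩
                    * star ((W ⟨b.src, ν⟩ : Matrix.specialUnitaryGroup (Fin 2) ℂ) : Matrix (Fin 2) (Fin 2) ℂ) - A b‖ ^ 2)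
            + CN'' * e ^ 2 * (F.L : ℝ) ^ l * (((F.L : ℝ) ^ (K - n)) ^ 2)⁻¹ * ∑ b : PBond (F.P K) 0, ‖A b‖ ^ 2) :
    ∀ (L : ℕ), 1 < L → ∃ Cr Cr' er : ℝ, 0 ≤ Cr ∧ 0 ≤ Cr' ∧ 0 < er ∧
      ∀ (F : T3Family), F.L = L → ∀ (n K : ℕ) (hnK : n < K) (e : ℝ) (W : GaugeField (F.P K) 0 (Matrix.specialUnitaryGroup (Fin 2) ℂ)),
        0 < e → e ≤ er → RegPr F n K e W → ∀ (A : PBond (F.P K) 0 → Matrix (Fin 2) (Fin 2) ℂ),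
        ∑ c : PBond (F.P n) 0,
          ‖fderiv ℂ (fun A : PBond (F.P K) 0 → Matrix (Fin 2) (Fin 2) ℂ => ((frameTw F n K hnK.le W A c.src : (Matrix (Fin 2) (Fin 2) ℂ)ˣ) : Matrix (Fin 2) (Fin 2) ℂ)) 0 A
              - ((Averaging.iter (fun i => blockAvg (P := F.P K) (j := i) (expMeanLogSU (n := Fin 2))) (K - n) W (bondShift (sites_eq F n K hnK.le) c) :
                  Matrix.specialUnitaryGroup (Fin 2) ℂ) : Matrix (Fin 2) (Fin 2) ℂ)
                * fderiv ℂ (fun A : PBond (F.P K) 0 → Matrix (Fin 2) (Fin 2) ℂ => ((frameTw F n K hnK.le W A c.tgt : (Matrix (Fin 2) (Fin 2) ℂ)ˣ) : Matrix (Fin 2) (Fin 2) ℂ)) 0 A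
                * star ((Averaging.iter (fun i => blockAvg (P := F.P K) (j := i) (expMeanLogSU (n := Fin 2))) (K - n) W (bondShift (sites_eq F n K hnK.le) c) :
                  Matrix.specialUnitaryGroup (Fin 2) ℂ) : Matrix (Fin 2) (Fin 2) ℂ)‖ ^ 2
          ≤ Cr * (F.L : ℝ) ^ (K - n) * (∑ b : PBond (F.P K) 0, ∑ ν : Fin (F.P K).d,
                ‖((W ⟨b.src, ν⟩ : Matrix.specialUnitaryGroup (Fin 2) ℂ) : Matrix (Fin 2) (Fin 2) ℂ) * A ⟨b.src.shift ν, b.dir⟩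
                    * star ((W ⟨b.src, ν⟩ : Matrix.specialUnitaryGroup (Fin 2) ℂ) : Matrix (Fin 2) (Fin 2) ℂ) - A b‖ ^ 2)
            + Cr' * e * ((F.L : ℝ) ^ (K - n))⁻¹ * ∑ b : PBond (F.P K) 0, ‖A b‖ ^ 2 := by
  intro L hL1
  by_cases hL3 : 3 ≤ L
  swap
  · -- no family has an odd block size `1 < L < 3`: the clause is vacuous
    refine ⟨0, 0, 1, le_rfl, le_rfl, one_pos, ?_⟩
    intro F hF n K hnK e W he he1 hreg A
    exfalso
    obtain ⟨a, ha⟩ := F.hL.1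
    have h2 := F.hL.2
    omega
  obtain ⟨CG, CG', eG, hCG0, hCG'0, heG, hGrow⟩ := hG L hL1
  obtain ⟨CN, CN', CN'', eN, hCN0, hCN'0, hCN''0, heN, hNrow⟩ := hN L hL1
  have hL3r : (3 : ℝ) ≤ (L : ℝ) := by exact_mod_cast hL3
  have hL0r : (0 : ℝ) < (L : ℝ) := by linarith
  have hL1r : (1 : ℝ) ≤ (L : ℝ) := by linarith
  -- the scalar knit's constants at the member's structure constants
  obtain ⟨Cr, Cr', hCr0, hCr'0, hknit⟩ := scalar_legs_knit_B hL3r (pM := 48 * ((L : ℝ) ^ 3)⁻¹ * (1798 * (L : ℝ) ^ 2) ^ 2) (aG := 36 * (L : ℝ) ^ 4)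
    (pN := 432 * (L : ℝ) ^ 2 * (1798 * (L : ℝ) ^ 2) ^ 2) (bN := 18 * (L : ℝ) ^ 2) (CG := 3 * CG) (CG' := 3 * CG') (CN := CN) (CN' := CN') (CN'' := CN'')
    (by positivity) (by positivity) (by positivity) (by positivity) (by positivity) (by positivity) hCN0 hCN'0 hCN''0
  -- the legs-mass coefficients and the swap constant
  have hgap1 : 0 < (L : ℝ)⁻¹ - 2 * ((L : ℝ) ^ 3)⁻¹ := by
    rw [show (L : ℝ) ^ 3 = L * L * L by ring, mul_inv, mul_inv]
    have hLi : 0 < (L : ℝ)⁻¹ := inv_pos.2 hL0r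
    have hLi1 : (L : ℝ)⁻¹ ≤ 1 / 3 := by rw [inv_eq_one_div]; exact one_div_le_one_div_of_le (by norm_num) hL3r
    nlinarith [mul_pos hLi hLi, mul_pos (mul_pos hLi hLi) hLi]
  have hgap2 : 0 < (L : ℝ) - 2 * ((L : ℝ) ^ 3)⁻¹ := by
    have : (L : ℝ)⁻¹ ≤ L := (inv_le_one_of_one_le₀ hL1r).trans hL1r
    linarith
  set m1 : ℝ := 18 * (L : ℝ) ^ 2 * (CN + CN'') / ((L : ℝ)⁻¹ - 2 * ((L : ℝ) ^ 3)⁻¹) with hm1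
  set m2 : ℝ := 18 * (L : ℝ) ^ 2 * CN' / ((L : ℝ) - 2 * ((L : ℝ) ^ 3)⁻¹) with hm2
  have hm10 : 0 ≤ m1 := div_nonneg (by positivity) hgap1.le
  have hm20 : 0 ≤ m2 := div_nonneg (by positivity) hgap2.le
  set Csw : ℝ := (5 * (L : ℝ)) ^ 2 / 4 * (10800 * (L : ℝ) + 1) + 256 * 4 * 7 * 2 with hCsw
  have hCsw0 : 0 ≤ Csw := by positivity
  refine ⟨2 * Cr + 24 * Csw ^ 2 * m2, 2 * Cr' + 24 * Csw ^ 2 * m1, min eG (min eN (min 1 (10 ^ 7 * (L : ℝ) ^ 3)⁻¹)), by positivity, by positivity,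
    lt_min heG (lt_min heN (lt_min one_pos (by positivity))), ?_⟩
  intro F hF n K hnK e W he heer hreg A
  subst hF
  -- the windows
  have heG' : e ≤ eG := heer.trans (min_le_left _ _)
  have heN' : e ≤ eN := heer.trans ((min_le_right _ _).trans (min_le_left _ _))
  have he1 : e ≤ 1 := heer.trans ((min_le_right _ _).trans ((min_le_right _ _).trans (min_le_left _ _)))
  have he3 : e ≤ (10 ^ 7 * (F.L : ℝ) ^ 3)⁻¹ := heer.trans ((min_le_right _ _).trans ((min_le_right _ _).trans (min_le_right _ _)))
  have hε : 10 ^ 7 * (F.L : ℝ) ^ 3 * e ≤ 1 := by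
    have hpos : (0 : ℝ) < 10 ^ 7 * (F.L : ℝ) ^ 3 := by positivity
    calc 10 ^ 7 * (F.L : ℝ) ^ 3 * e ≤ 10 ^ 7 * (F.L : ℝ) ^ 3 * (10 ^ 7 * (F.L : ℝ) ^ 3)⁻¹ := mul_le_mul_of_nonneg_left he3 hpos.le
      _ = 1 := mul_inv_cancel₀ hpos.ne'
  have hkm : K - n ≤ F.m + K := by omega
  -- the two quadratic forms of `A`
  set GA : ℝ := ∑ b : PBond (F.P K) 0, ∑ ν : Fin (F.P K).d,
      ‖((W ⟨b.src, ν⟩ : Matrix.specialUnitaryGroup (Fin 2) ℂ) : Matrix (Fin 2) (Fin 2) ℂ) * A ⟨b.src.shift ν, b.dir⟩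
          * star ((W ⟨b.src, ν⟩ : Matrix.specialUnitaryGroup (Fin 2) ℂ) : Matrix (Fin 2) (Fin 2) ℂ) - A b‖ ^ 2 with hGA
  set SA : ℝ := ∑ b : PBond (F.P K) 0, ‖A b‖ ^ 2 with hSA
  have hGA0 : 0 ≤ GA := Finset.sum_nonneg fun _ _ => Finset.sum_nonneg fun _ _ => by positivity
  have hSA0 : 0 ≤ SA := Finset.sum_nonneg fun _ _ => by positivity
  -- the letters
  set Y : ℕ → LSite (F.P K).d → Fin (F.P K).d → Matrix (Fin 2) (Fin 2) ℂ := fun l x κ =>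
    fderiv ℂ (fun t : PBond (F.P K) 0 → Matrix (Fin 2) (Fin 2) ℂ =>
      ((tildIter (F.P K).L (pull (bgUnits F K W) (basePt F n K)) (pull (fun b => expUnit (t b)) (basePt F n K)) l x κ : (Matrix (Fin 2) (Fin 2) ℂ)ˣ) :
        Matrix (Fin 2) (Fin 2) ℂ)) 0 A with hYd
  set D : ℕ → LSite (F.P K).d → Matrix (Fin 2) (Fin 2) ℂ := fun l z =>
    fderiv ℂ (fun t : PBond (F.P K) 0 → Matrix (Fin 2) (Fin 2) ℂ =>
      ((vcov (F.P K).L (pull (bgUnits F K W) (basePt F n K)) (pull (fun b => expUnit (t b)) (basePt F n K)) l z : (Matrix (Fin 2) (Fin 2) ℂ)ˣ) : Matrix (Fin 2) (Fin 2) ℂ)) 0 A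
    with hDd
  have hY : ∀ l x κ, Y l x κ = fderiv ℂ (fun t : PBond (F.P K) 0 → Matrix (Fin 2) (Fin 2) ℂ =>
      ((tildIter (F.P K).L (pull (bgUnits F K W) (basePt F n K)) (pull (fun b => expUnit (t b)) (basePt F n K)) l x κ : (Matrix (Fin 2) (Fin 2) ℂ)ˣ) :
        Matrix (Fin 2) (Fin 2) ℂ)) 0 A := fun _ _ _ => rfl
  have hD : ∀ l z, D l z = fderiv ℂ (fun t : PBond (F.P K) 0 → Matrix (Fin 2) (Fin 2) ℂ =>
      ((vcov (F.P K).L (pull (bgUnits F K W) (basePt F n K)) (pull (fun b => expUnit (t b)) (basePt F n K)) l z : (Matrix (Fin 2) (Fin 2) ℂ)ˣ) : Matrix (Fin 2) (Fin 2) ℂ)) 0 A :=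
    fun _ _ => rfl
  -- the scalar sequences
  set E : ℕ → ℝ := fun l => ∑ μ : Fin (F.P K).d, ∑ x : Site (F.P K) l,
      ‖D l (fun ν => ((x ν).val : ℤ)) - conjR (avgIter (F.P K).L (pull (bgUnits F K W) (basePt F n K)) l (fun ν => ((x ν).val : ℤ)) μ) (D l ((fun ν => ((x ν).val : ℤ)) + B7Prop1Explicit.e μ))‖ ^ 2
    with hEd
  set M : ℕ → ℝ := fun l => ∑ x : Site (F.P K) l, ‖D l (fun ν => ((x ν).val : ℤ))‖ ^ 2 with hMd
  set G : ℕ → ℝ := fun l => ∑ μ : Fin (F.P K).d, ∑ x : Site (F.P K) l, ∑ κ : Fin (F.P K).d,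
      ‖Y l (fun ν => ((x ν).val : ℤ)) κ - conjR (avgIter (F.P K).L (pull (bgUnits F K W) (basePt F n K)) l (fun ν => ((x ν).val : ℤ)) μ) (Y l ((fun ν => ((x ν).val : ℤ)) + B7Prop1Explicit.e μ) κ)‖ ^ 2
    with hGd
  set N : ℕ → ℝ := fun l => ∑ x : Site (F.P K) l, ∑ κ : Fin (F.P K).d, ‖Y l (fun ν => ((x ν).val : ℤ)) κ‖ ^ 2 with hNd
  set a : ℕ → ℝ := fun l => 2 * (2 * e * (((F.L : ℝ)) ^ l * (((F.L : ℝ)) ^ (K - n))⁻¹) ^ 2) with had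
  -- the hypotheses of the scalar knit
  have hD0 : ∀ z, D 0 z = 0 := fun z => linVcov_zero_of F W A D hD z
  have hE0 : E 0 ≤ 0 := by
    refine le_of_eq (Finset.sum_eq_zero fun μ _ => Finset.sum_eq_zero fun x _ => ?_)
    rw [hD0, hD0, conjR_apply, mul_zero, zero_mul, sub_zero, norm_zero]; simp
  have hM0 : M 0 ≤ 0 := by
    refine le_of_eq (Finset.sum_eq_zero fun x _ => ?_)
    rw [hD0, norm_zero]; simp
  have hMnn : ∀ l, 0 ≤ M l := fun l => Finset.sum_nonneg fun _ _ => by positivity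
  have hNnn : ∀ l, 0 ≤ N l := fun l => Finset.sum_nonneg fun _ _ => Finset.sum_nonneg fun _ _ => by positivity
  have hann : ∀ l, 0 ≤ a l := fun l => by positivity
  have ha : ∀ l, l < K - n → a l ≤ 4 * e * ((F.L : ℝ) ^ l * ((F.L : ℝ) ^ (K - n))⁻¹) ^ 2 := fun l _ => le_of_eq (by rw [had]; ring)
  have hGb : ∀ l, l < K - n → G l ≤ 3 * CG * (F.L : ℝ) ^ l * GA + 3 * CG' * e ^ 2 * (F.L : ℝ) ^ l * (((F.L : ℝ) ^ (K - n)) ^ 2)⁻¹ * SA := by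
    intro l hl
    have hrow := fun μ : Fin (F.P K).d => hGrow F rfl n K hnK e W he heG' hreg A l hl μ
    calc G l ≤ ∑ μ : Fin (F.P K).d, (CG * (F.L : ℝ) ^ l * GA + CG' * e ^ 2 * (F.L : ℝ) ^ l * (((F.L : ℝ) ^ (K - n)) ^ 2)⁻¹ * SA) :=
          Finset.sum_le_sum fun μ _ => hrow μ
      _ = _ := by
          rw [Finset.sum_const, Finset.card_univ, Fintype.card_fin, nsmul_eq_mul, show (((F.P K).d : ℕ) : ℝ) = 3 from by rw [T3Family.P_d]; norm_num]
          ring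
  have hNb : ∀ l, l < K - n → N l ≤ CN * ((F.L : ℝ) ^ l)⁻¹ * SA + CN' * (F.L : ℝ) ^ l * GA + CN'' * e ^ 2 * (F.L : ℝ) ^ l * (((F.L : ℝ) ^ (K - n)) ^ 2)⁻¹ * SA :=
    fun l hl => hNrow F rfl n K hnK e W he heN' hreg A l hl
  have hMb : ∀ l, l < K - n → M (l + 1) ≤ 2 * ((F.L : ℝ) ^ 3)⁻¹ * M l + 18 * (F.L : ℝ) ^ 2 * N l :=
    fun l hl => legsMass_level_step_of_regPr F he hε W hreg A Y hY D hD (Nat.succ_le_of_lt hl)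
  have hEb : ∀ l, l < K - n → E (l + 1) ≤ 4 * (F.L : ℝ)⁻¹ * E l + (48 * ((F.L : ℝ) ^ 3)⁻¹ * (1798 * (F.L : ℝ) ^ 2) ^ 2) * a l ^ 2 * M l
      + 36 * (F.L : ℝ) ^ 4 * G l + (432 * (F.L : ℝ) ^ 2 * (1798 * (F.L : ℝ) ^ 2) ^ 2) * a l ^ 2 * N l :=
    fun l hl => legs_level_step_of_regPr F he hε W hreg A Y hY D hD (Nat.succ_le_of_lt hl)
  -- (1) the top legs and the top legs-mass
  have hEk : E (K - n) ≤ Cr * (F.L : ℝ) ^ (K - n) * GA + Cr' * e * ((F.L : ℝ) ^ (K - n))⁻¹ * SA :=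
    hknit (K - n) e GA SA he he1 hGA0 hSA0 E M G N a hE0 hM0 hMnn hNnn hann ha hGb hNb hMb hEb
  have hMk : M (K - n) ≤ m1 * SA * (F.L : ℝ)⁻¹ ^ (K - n) + m2 * GA * (F.L : ℝ) ^ (K - n) := by
    have h := legsMass_le_B hL3r (bN := 18 * (F.L : ℝ) ^ 2) (by positivity) hCN0 hCN'0 hCN''0 (K - n) he.le he1 hGA0 hSA0 M N hM0 hNb hMb (K - n) le_rfl
    exact h
  -- (2) the top swap and the re-indexing
  obtain ⟨hV, -, -, -⟩ := level_data_of_regPr F he hε W hreg (le_refl (K - n))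
  have hDper : IsPeriodic ((F.P K).sitesPerDir (K - n)) (D (K - n)) := isPeriodic_linVcov_of F W A D hD hkm
  have hse : 0 ≤ Csw * e := by positivity
  have htop := sum_coarseBond_legs_le F hnK.le W (D (K - n)) hDper hV hse (fun c => norm_iterEML_sub_avgIter_le_of_regPr F he hε hreg hnK.le c)
  rw [sum_dir_shift_normSq_eq F (D (K - n)) hDper] at htop
  -- (3) the frames are the top comb frames (`r(y)A = D_k(coordT3 y)`)
  simp only [fderiv_frameTw_eq_fderiv_vcov F hnK.le W]
  -- (4) the final arithmetic
  have hLk : (0 : ℝ) < (F.L : ℝ) ^ (K - n) := by positivity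
  exact final_arith he.le he1 hGA0 hSA0 hLk (inv_pow (F.L : ℝ) (K - n)) hm10 hm20 htop hEk hMk

/-! ## §2 ★★★ The curved row `rlegs` from the two anchored rows (✓p707999 ∘ §1) -/

/-- ★★★ **px19's SIGNATURE-0 ROW `rlegs` (curl∕div form) FROM THE TWO `ℓ⁻²`-ANCHORED PER-LEVEL ROWS OF THE COMB LINEAR TOWER**: ✓p707999 `rlegs_of_covGradLegs` ∘ `covGradLegs_of_linTower_rowsB`.
[cite: Balaban1985Averaging, (110)–(112) p.34, (160)–(163) p.42; Balaban1985BackgroundPropagators, (3.41)–(3.43) p.397, (3.44) p.398] -/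
theorem rlegs_of_linTower_rowsB
    (hG : ∀ (L : ℕ), 1 < L → ∃ CG CG' eG : ℝ, 0 ≤ CG ∧ 0 ≤ CG' ∧ 0 < eG ∧
      ∀ (F : T3Family), F.L = L → ∀ (n K : ℕ) (hnK : n < K) (e : ℝ) (W : GaugeField (F.P K) 0 (Matrix.specialUnitaryGroup (Fin 2) ℂ)),
        0 < e → e ≤ eG → RegPr F n K e W → ∀ (A : PBond (F.P K) 0 → Matrix (Fin 2) (Fin 2) ℂ) (l : ℕ), l < K - n → ∀ μ : Fin (F.P K).d,
        ∑ x : Site (F.P K) l, ∑ κ : Fin (F.P K).d,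
          ‖fderiv ℂ (fun t : PBond (F.P K) 0 → Matrix (Fin 2) (Fin 2) ℂ =>
                ((tildIter (F.P K).L (pull (bgUnits F K W) (basePt F n K)) (pull (fun b => expUnit (t b)) (basePt F n K)) l (fun ν => ((x ν).val : ℤ)) κ :
                  (Matrix (Fin 2) (Fin 2) ℂ)ˣ) : Matrix (Fin 2) (Fin 2) ℂ)) 0 A
            - conjR (avgIter (F.P K).L (pull (bgUnits F K W) (basePt F n K)) l (fun ν => ((x ν).val : ℤ)) μ)
              (fderiv ℂ (fun t : PBond (F.P K) 0 → Matrix (Fin 2) (Fin 2) ℂ =>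
                ((tildIter (F.P K).L (pull (bgUnits F K W) (basePt F n K)) (pull (fun b => expUnit (t b)) (basePt F n K)) l ((fun ν => ((x ν).val : ℤ)) + B7Prop1Explicit.e μ) κ :
                  (Matrix (Fin 2) (Fin 2) ℂ)ˣ) : Matrix (Fin 2) (Fin 2) ℂ)) 0 A)‖ ^ 2
          ≤ CG * (F.L : ℝ) ^ l * (∑ b : PBond (F.P K) 0, ∑ ν : Fin (F.P K).d,
                ‖((W ⟨b.src, ν⟩ : Matrix.specialUnitaryGroup (Fin 2) ℂ) : Matrix (Fin 2) (Fin 2) ℂ) * A ⟨b.src.shift ν, b.dir⟩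
                    * star ((W ⟨b.src, ν⟩ : Matrix.specialUnitaryGroup (Fin 2) ℂ) : Matrix (Fin 2) (Fin 2) ℂ) - A b‖ ^ 2)
            + CG' * e ^ 2 * (F.L : ℝ) ^ l * (((F.L : ℝ) ^ (K - n)) ^ 2)⁻¹ * ∑ b : PBond (F.P K) 0, ‖A b‖ ^ 2)
    (hN : ∀ (L : ℕ), 1 < L → ∃ CN CN' CN'' eN : ℝ, 0 ≤ CN ∧ 0 ≤ CN' ∧ 0 ≤ CN'' ∧ 0 < eN ∧
      ∀ (F : T3Family), F.L = L → ∀ (n K : ℕ) (hnK : n < K) (e : ℝ) (W : GaugeField (F.P K) 0 (Matrix.specialUnitaryGroup (Fin 2) ℂ)),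
        0 < e → e ≤ eN → RegPr F n K e W → ∀ (A : PBond (F.P K) 0 → Matrix (Fin 2) (Fin 2) ℂ) (l : ℕ), l < K - n →
        ∑ x : Site (F.P K) l, ∑ κ : Fin (F.P K).d,
          ‖fderiv ℂ (fun t : PBond (F.P K) 0 → Matrix (Fin 2) (Fin 2) ℂ =>
                ((tildIter (F.P K).L (pull (bgUnits F K W) (basePt F n K)) (pull (fun b => expUnit (t b)) (basePt F n K)) l (fun ν => ((x ν).val : ℤ)) κ :
                  (Matrix (Fin 2) (Fin 2) ℂ)ˣ) : Matrix (Fin 2) (Fin 2) ℂ)) 0 A‖ ^ 2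
          ≤ CN * ((F.L : ℝ) ^ l)⁻¹ * ∑ b : PBond (F.P K) 0, ‖A b‖ ^ 2
            + CN' * (F.L : ℝ) ^ l * (∑ b : PBond (F.P K) 0, ∑ ν : Fin (F.P K).d,
                ‖((W ⟨b.src, ν⟩ : Matrix.specialUnitaryGroup (Fin 2) ℂ) : Matrix (Fin 2) (Fin 2) ℂ) * A ⟨b.src.shift ν, b.dir⟩
                    * star ((W ⟨b.src, ν⟩ : Matrix.specialUnitaryGroup (Fin 2) ℂ) : Matrix (Fin 2) (Fin 2) ℂ) - A b‖ ^ 2)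
            + CN'' * e ^ 2 * (F.L : ℝ) ^ l * (((F.L : ℝ) ^ (K - n)) ^ 2)⁻¹ * ∑ b : PBond (F.P K) 0, ‖A b‖ ^ 2) :
    ∀ (L : ℕ), 1 < L → ∃ Cr Cr' er : ℝ, 0 ≤ Cr ∧ 0 ≤ Cr' ∧ 0 < er ∧
    ∀ (F : T3Family), F.L = L → ∀ (n K : ℕ) (hnK : n < K) (e : ℝ) (W : GaugeField (F.P K) 0 (Matrix.specialUnitaryGroup (Fin 2) ℂ)),
      0 < e → e ≤ er → RegPr F n K e W → ∀ (A : PBond (F.P K) 0 → Matrix (Fin 2) (Fin 2) ℂ),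
      ∑ c : PBond (F.P n) 0,
        ‖fderiv ℂ (fun A : PBond (F.P K) 0 → Matrix (Fin 2) (Fin 2) ℂ => ((frameTw F n K hnK.le W A c.src : (Matrix (Fin 2) (Fin 2) ℂ)ˣ) : Matrix (Fin 2) (Fin 2) ℂ)) 0 A
            - ((Averaging.iter (fun i => blockAvg (P := F.P K) (j := i) (expMeanLogSU (n := Fin 2))) (K - n) W (bondShift (sites_eq F n K hnK.le) c) :
                Matrix.specialUnitaryGroup (Fin 2) ℂ) : Matrix (Fin 2) (Fin 2) ℂ)
              * fderiv ℂ (fun A : PBond (F.P K) 0 → Matrix (Fin 2) (Fin 2) ℂ => ((frameTw F n K hnK.le W A c.tgt : (Matrix (Fin 2) (Fin 2) ℂ)ˣ) : Matrix (Fin 2) (Fin 2) ℂ)) 0 A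
              * star ((Averaging.iter (fun i => blockAvg (P := F.P K) (j := i) (expMeanLogSU (n := Fin 2))) (K - n) W (bondShift (sites_eq F n K hnK.le) c) :
                Matrix.specialUnitaryGroup (Fin 2) ℂ) : Matrix (Fin 2) (Fin 2) ℂ)‖ ^ 2
        ≤ Cr * (F.L : ℝ) ^ (K - n) * ((∑ x : Site (F.P K) 0, ∑ μ : Fin (F.P K).d, ∑ ν : Fin (F.P K).d,
              (if μ < ν then ∑ j : Fin 2, ∑ k : Fin 2,
                ‖(curl (torusT (F.P K) 0) (fun κ z => unitsField (toUField W) ⟨z, κ⟩) (fun κ z => A ⟨z, κ⟩) μ ν x) j k‖ ^ 2 else 0))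
            + (∑ x : Site (F.P K) 0, ∑ j : Fin 2, ∑ k : Fin 2,
              ‖(divB (torusT (F.P K) 0) (fun κ z => unitsField (toUField W) ⟨z, κ⟩) (fun κ z => A ⟨z, κ⟩) x) j k‖ ^ 2))
          + Cr' * e * ((F.L : ℝ) ^ (K - n))⁻¹ * ∑ b : PBond (F.P K) 0, ‖A b‖ ^ 2 :=
  Summit.QuantumFields.YangMills.Theorems.Prop7RLegsOfCovGrad.rlegs_of_covGradLegs (covGradLegs_of_linTower_rowsB hG hN)


end Summit.QuantumFields.YangMills.Theorems.Prop7RLegsCovKnitB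

end
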